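import Summits.HodgeConjecture.HodgeConjecture.Theorems.Ring2AbelianAllAndreLiebermanHolds
import Summits.HodgeConjecture.HodgeConjecture.Theorems.Ring2AbelianAllAndrePrimitiveLiftLieberman
import Summits.HodgeConjecture.HodgeConjecture.Theorems.Ring2AbelianAllAndrePrimitiveLiftRankOne
import Summits.HodgeConjecture.HodgeConjecture.Theorems.Ring2AbelianAllAndreJunction
import HarnessLib

/-!
# Ring 2 · sub-cell AbelianAll, André axis, part XXII-d — THE `hL` BINDER REMOVED: the André-axis rows that were
# "modulo Lieberman" restated UNCONDITIONALLY, and the Abdulali named facts `h₈A`, `h₈` DISCHARGED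

HONEST FRAMING (page 1, verbatim): **research route, not a corollary; conditional on HC_CM plus one named
minimal statement.** Cell line: research route conditional on HC_CM; not a corollary; Q11.4-sentence-2
already refuted in dim ≥ 3. Nothing in this file proves a case of the Hodge conjecture for an abelian variety
(`HC_CM` occurs only as the binder `hCM` of the one cell row restated in §3). Seat `pub-hodge-ring2-ab-andre-2`, gen 14.

Part XXII-c proved `lieberman1968_lefschetzInvolution_algebraic_abelianVariety_holds` (Lieberman 1968 / Kleiman 2A11:
`B(A)` for every complex abelian variety, on the real carriers). This file feeds it into the `_of_lieberman` rows of parts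
XVIII-e and XXI-c BY NAME; every statement below is the earlier statement with the hypothesis
`(hL : Lieberman1968_lefschetzInvolution_algebraic_abelianVariety)` deleted.

* §1 **`A(X, η)` for every complex abelian variety and every polarisation** (`forall_standardConjectureA_abelianVariety`),
  for every fibre of a compact abelian pencil (`standardConjectureA_fiberOver`), hom ≡ num non-degeneracy of the algebraic
  classes of the fibres (`nondegenerate_fiberOver`), hence **(Num_t)(p,q) ⟹ (L)_t(p) at every point** (`comap_le_sup_of_numerical`).
* §2 **Abdulali's named facts are theorems of the tree**: `abdulali1994A_holds : Abdulali1994_invariantCycles_of_lefschetzStandardA`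
  and `abdulali1994_holds : Abdulali1994_invariantCycles_of_lefschetzStandard` (ab-andre-1's `h₈A`, `h₈`); the VHC rows
  `A_pen ⟹ (2)`, `A_pen^CM ⟹ (3)` binder-free.
* §3 **The reduction of the André-axis lift to the PRIMITIVE invariant algebraic classes holds at EVERY point of EVERY compact
  abelian pencil, UNCONDITIONALLY** (`forall_comap_le_sup_iff_primitiveLift`); node level `(L) ⟺ [CM primitive lift]`,
  `(L∀) ⟺ [primitive lift everywhere]`, `[primitive lift everywhere] ⟹ (2)` with NO binder; `HC_AV ⟺ HC_CM ∧ [primitive lift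
  everywhere]` modulo `[h₂₁, Verdier]` only; `(Num_t) ⟹ (Prim)_t` fact-free.
* §4 the W₆ habitat row of part XXI-e (rank-one `H⁴`-invariants on a pencil of abelian sixfolds: whole lift ⟺ (Prim)_t(3))
  without its `A(X_t, κ)` clause (`forall_comap_le_sup_iff_primitiveLift_three_of_rankOne`).
* §5 the Lefschetz-flavoured rows of gen 1 (parts II/III) without the Abdulali binder `h₈`: (5) ⟹ (3), (5∀) ⟹ (2) with NO binder,
  **`HC_AV_of_HC_CM_of_lefschetzBCMPointedPencils (h₂₁) (hCM) (hB)`** (the Lefschetz-flavoured deliverable modulo `h₂₁` only),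
  `HC_AV_of_andre1996_of_lefschetzBCompactPencils` (KIND-1, no `HC_CM`, modulo `h₂₁`, `h₂₂`).

The display brackets `CMPrimitiveLift[]`, `PrimitiveLiftEverywhere[]` are the `local notation3` of part XXI-c, copied
verbatim (no definition). EDGE LABELS (RING2-MAP §AbelianAll gen 14): every former `K[hL]` is `K`; the HC_AV iff is
`K[h₂₁, Verdier]`. References: Lieberman1968 (main theorem); Kleiman1968AlgebraicCycles (§3, App. to §2 Thm. 2A11);
Grothendieck1968 (§3 p. 196); Abdulali1994FamiliesAV ((1.1) p. 1122, pp. 1122–1123); Milne2020HodgeClassesAV (Prop. 1 p. 7);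
Andre1996Motifs (§5.1, Lemme 6.3.1, §6.3, Remarque 2); Verdier1976 (Cor. (5.1)).
-/

noncomputable section

set_option linter.dupNamespace false

namespace Summit.HodgeConjecture.HodgeConjecture.Ring2.AbelianAll

open CategoryTheory AlgebraicGeometry
open Literature.AlgebraicGeometry Literature.AlgebraicGeometry.Motives
open Literature.AlgebraicGeometry.HodgeTheory
open Literature.AlgebraicTopology.SingularHomology (singularCohomology cupProduct)
open Literature.AlgebraicGeometry.Abdulali1994 (InvariantCyclesHoldFor Abdulali1994_invariantCycles_of_lefschetzStandardA
  Abdulali1994_invariantCycles_of_lefschetzStandard)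
open Literature.AlgebraicGeometry.Deligne1982 (cmLocus)
open Literature.AlgebraicGeometry.Andre1996 (andre1996_cmAnchoredPencil andre1996_cmHodgeClasses_algebraicallyAnchoredPencils)
open Summit.HodgeConjecture.HodgeConjecture.Theses
open Summit.HodgeConjecture.HodgeConjecture.Ring2.Deform (CompactAbelianPencilVHC CMPointedCompactPencilVHC)

variable {𝒳 S : SchemeOver ℂ}

/-! ## §1 Grothendieck's `A(X, η)` for complex abelian varieties, unconditionally -/

/-- **`A(A, η)` for EVERY complex abelian variety `A` and every polarisation class `η`** (Kleiman: `B ⟹ A`; `B(A)` is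
part XXII-c's theorem). [cite: Kleiman1968AlgebraicCycles, Appendix to §2, Thm. 2A11 and §2] [cite: Grothendieck1968, §3 p. 196]
[cite: Lieberman1968, main theorem] -/
theorem forall_standardConjectureA_abelianVariety (A : AbelianVariety ℂ) :
    ∀ η : complexBetti A.X 2, IsPolarizationClass A.dim A.X η → StandardConjectureA A.dim A.X η :=
  forall_standardConjectureA_abelianVariety_of_lieberman lieberman1968_lefschetzInvolution_algebraic_abelianVariety_holds A

/-- **`A(X_t, κ)` for every fibre of a compact pencil of abelian varieties and every polarisation class `κ` of the fibre**,
unconditionally (part XXI-c's `standardConjectureA_fiberOver_of_lieberman`). [cite: Lieberman1968, main theorem]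
[cite: Grothendieck1968, §3 p. 196] -/
theorem standardConjectureA_fiberOver {d : ℕ} {f : 𝒳 ⟶ S} (hf : IsCompactAbelianPencil f d) (t : ComplexPoints S)
    {κ : complexBetti (fiberOver f t) 2} (hκ : IsPolarizationClass d (fiberOver f t) κ) :
    StandardConjectureA d (fiberOver f t) κ :=
  standardConjectureA_fiberOver_of_lieberman lieberman1968_lefschetzInvolution_algebraic_abelianVariety_holds hf t hκ

/-- **Hom ≡ num on the fibres, unconditionally**: the cup pairing between the algebraic classes of complementary
codimensions of any fibre of a compact abelian pencil is non-degenerate on both sides (part XVIII-e's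
`nondegenerate_fiberOver_of_lieberman`; Lieberman's `D(A)`). [cite: Lieberman1968, main theorem] [cite: Kleiman1968AlgebraicCycles, §3] -/
theorem nondegenerate_fiberOver {d : ℕ} {f : 𝒳 ⟶ S} (hf : IsCompactAbelianPencil f d) (t : ComplexPoints S) {p q : ℕ}
    (hpq : p + q = d) :
    (∀ ξ ∈ algebraicClasses (fiberOver f t) p,
        (∀ b ∈ algebraicClasses (fiberOver f t) q, cupProduct (show 2 * p + 2 * q = 2 * d by omega) ξ b = 0) → ξ = 0) ∧
      (∀ b ∈ algebraicClasses (fiberOver f t) q,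
        (∀ ξ ∈ algebraicClasses (fiberOver f t) p, cupProduct (show 2 * p + 2 * q = 2 * d by omega) ξ b = 0) → b = 0) :=
  nondegenerate_fiberOver_of_lieberman lieberman1968_lefschetzInvolution_algebraic_abelianVariety_holds hf t hpq


/-- **(Num_t)(p,q) ⟹ (L)_t(p) at EVERY point of EVERY compact pencil of abelian varieties, NO binder**: conjecture D for the
fibre-supported classes `j_{t*}N^q(X_t)` of the total space gives the lift in degree `2p` (`p + q = d`) — part XVIII-a's
`comap_le_sup_of_nondegenerate_of_numerical`, whose two non-degeneracy hypotheses (Perf_t) are `nondegenerate_fiberOver` (§1).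
(Parts XVIII-c had this at HC fibres / CM fibres under `HC_CM` only.) [cite: Kleiman1968AlgebraicCycles, §3] [cite: Milne2020HodgeClassesAV, Prop. 1 (p. 7)]
[cite: Lieberman1968, main theorem] -/
theorem comap_le_sup_of_numerical {d : ℕ} {f : 𝒳 ⟶ S} (hf : IsCompactAbelianPencil f d) (t : ComplexPoints S) {p q : ℕ}
    (hpq : p + q = d)
    (hNum : ∀ b ∈ algebraicClasses (fiberOver f t) q,
      (∀ a ∈ algebraicClasses 𝒳 p,
        cupProduct (show 2 * p + 2 * (q + 1) = 2 * (d + 1) by omega) a (fiberGysin hf t q b) = 0) →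
        fiberGysin hf t q b = 0) :
    (algebraicClasses (fiberOver f t) p).comap (complexBetti.map (fiberι f t) (2 * p)).hom ≤
      algebraicClasses 𝒳 p ⊔ LinearMap.ker (complexBetti.map (fiberι f t) (2 * p)).hom := by
  obtain ⟨h₁, h₂⟩ := nondegenerate_fiberOver hf t hpq
  exact comap_le_sup_of_nondegenerate_of_numerical hf t hpq h₁ h₂ hNum

/-! ## §2 Abdulali's named facts `h₈A`, `h₈` are theorems; the VHC rows binder-free -/

/-- **DISCHARGE of `Abdulali1994_invariantCycles_of_lefschetzStandardA`** (ab-andre-1's `h₈A`; Abdulali 1994 pp. 1122–1123 /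
Milne 2020 Prop. 1 in `A`-form): part XVIII-e's `abdulali1994A_of_lieberman` with Lieberman's theorem supplied.
[cite: Abdulali1994FamiliesAV, (1.1) p. 1122 and pp. 1122–1123] [cite: Milne2020HodgeClassesAV, Prop. 1 (p. 7)] [cite: Lieberman1968, main theorem] -/
theorem abdulali1994A_holds : Abdulali1994_invariantCycles_of_lefschetzStandardA :=
  abdulali1994A_of_lieberman lieberman1968_lefschetzInvolution_algebraic_abelianVariety_holds

/-- **DISCHARGE of `Abdulali1994_invariantCycles_of_lefschetzStandard`** (ab-andre-1's `h₈`; Abdulali 1994 pp. 1122–1123 /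
Milne 2020 Prop. 1): part XVIII-e's `abdulali1994_of_lieberman` with Lieberman's theorem supplied.
[cite: Abdulali1994FamiliesAV, (1.1) p. 1122 and pp. 1122–1123] [cite: Milne2020HodgeClassesAV, Prop. 1 (p. 7)] [cite: Lieberman1968, main theorem] -/
theorem abdulali1994_holds : Abdulali1994_invariantCycles_of_lefschetzStandard :=
  abdulali1994_of_lieberman lieberman1968_lefschetzInvolution_algebraic_abelianVariety_holds

/-- **`A(𝒳)` for the total space of a compact abelian pencil ⟹ Abdulali's (1.1) for that pencil**, binder-free
(part XVIII-e's `invariantCyclesHoldFor_of_lieberman_of_standardConjectureA`). [cite: Abdulali1994FamiliesAV, (1.1) p. 1122]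
[cite: Kleiman1968AlgebraicCycles, §3] -/
theorem invariantCyclesHoldFor_of_standardConjectureA {d : ℕ} {f : 𝒳 ⟶ S} (hf : IsCompactAbelianPencil f d)
    (hA : ∀ η : complexBetti 𝒳 2, IsPolarizationClass (d + 1) 𝒳 η → StandardConjectureA (d + 1) 𝒳 η) :
    InvariantCyclesHoldFor f d :=
  invariantCyclesHoldFor_of_lieberman_of_standardConjectureA lieberman1968_lefschetzInvolution_algebraic_abelianVariety_holds
    hf hA

/-- **`A_pen ⟹ (2)`** binder-free: `A` on all compact abelian pencil total spaces ⟹ VHC on compact abelian pencils.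
[cite: Abdulali1994FamiliesAV, (1.1) p. 1122] [cite: Milne2020HodgeClassesAV, Prop. 1 (p. 7)] -/
theorem compactAbelianPencilVHC_of_compactAbelianPencilStandardA (hA : CompactAbelianPencilStandardA) :
    CompactAbelianPencilVHC :=
  compactAbelianPencilVHC_of_lieberman_of_compactAbelianPencilStandardA
    lieberman1968_lefschetzInvolution_algebraic_abelianVariety_holds hA

/-- **`A_pen^CM ⟹ (3)`** binder-free: `A` on the CM-pointed compact abelian pencil total spaces ⟹ VHC on CM-pointed compact
pencils. [cite: Abdulali1994FamiliesAV, (1.1) p. 1122] [cite: Milne2020HodgeClassesAV, Prop. 1 (p. 7)] -/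
theorem cmPointedCompactPencilVHC_of_cmPointedPencilStandardA (hA : CMPointedPencilStandardA) :
    CMPointedCompactPencilVHC :=
  cmPointedCompactPencilVHC_of_lieberman_of_cmPointedPencilStandardA
    lieberman1968_lefschetzInvolution_algebraic_abelianVariety_holds hA

/-! ## §3 The reduction to the primitive invariant algebraic classes, at every point of every pencil, unconditionally -/

/-- **THE ANDRÉ-AXIS LIFT REDUCES TO THE PRIMITIVE LIFTS — EVERY compact pencil of abelian varieties, EVERY point, NO binder.**
For a compact pencil `f : 𝒳 ⟶ S` of abelian `d`-folds, a point `t`, and a global algebraic class `K ∈ N¹(𝒳)` polarising every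
fibre: the lift (L)_t in every degree (`(j_t^*)⁻¹N^p(X_t) ≤ N^p(𝒳) + ker j_t^*` for all `p`) holds iff the `κ_t`-PRIMITIVE
invariant algebraic classes of degrees `4 ≤ 2r ≤ d` lie in `j_t^* N^r(𝒳)` (part XXI-c's
`forall_comap_le_sup_iff_primitiveLift_of_lieberman`, Lieberman's theorem now supplied by part XXII-c).
[cite: Lieberman1968, main theorem] [cite: Kleiman1968AlgebraicCycles, §3] [cite: VoisinHodgeI2002, §6.2.3 Cor. 6.26]
[cite: Milne2020HodgeClassesAV, Prop. 1 (p. 7)] -/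
theorem forall_comap_le_sup_iff_primitiveLift {d : ℕ} {f : 𝒳 ⟶ S} (hf : IsCompactAbelianPencil f d) (t : ComplexPoints S)
    {K : complexBetti 𝒳 2} (hKalg : K ∈ algebraicClasses 𝒳 1)
    (hKs : ∀ s : ComplexPoints S, IsPolarizationClass d (fiberOver f s) (complexBetti.map (fiberι f s) 2 K)) :
    (∀ p : ℕ, (algebraicClasses (fiberOver f t) p).comap (complexBetti.map (fiberι f t) (2 * p)).hom ≤
      algebraicClasses 𝒳 p ⊔ LinearMap.ker (complexBetti.map (fiberι f t) (2 * p)).hom) ↔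
    ∀ r, 2 ≤ r → 2 * r ≤ d → ∀ ξ ∈ algebraicClasses (fiberOver f t) r,
      ξ ∈ primitiveClasses (complexBetti.map (fiberι f t) 2 K) d (2 * r) →
      ξ ∈ LinearMap.range (complexBetti.map (fiberι f t) (2 * r)).hom →
      ξ ∈ (algebraicClasses 𝒳 r).map (complexBetti.map (fiberι f t) (2 * r)).hom :=
  forall_comap_le_sup_iff_primitiveLift_of_lieberman lieberman1968_lefschetzInvolution_algebraic_abelianVariety_holds hf t
    hKalg hKs

/-- **(Num_t) in all bidegrees ⟹ (Prim)_t, fact-free** (part XXI-c's `primitiveLift_of_numerical_of_lieberman`).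
[cite: Lieberman1968, main theorem] [cite: Kleiman1968AlgebraicCycles, §3] -/
theorem primitiveLift_of_numerical {d : ℕ} {f : 𝒳 ⟶ S} (hf : IsCompactAbelianPencil f d) (t : ComplexPoints S)
    (K : complexBetti 𝒳 2)
    (hNum : ∀ (p q : ℕ) (hpq : p + q = d), ∀ b ∈ algebraicClasses (fiberOver f t) q,
      (∀ a ∈ algebraicClasses 𝒳 p,
        cupProduct (show 2 * p + 2 * (q + 1) = 2 * (d + 1) by omega) a (fiberGysin hf t q b) = 0) →
        fiberGysin hf t q b = 0)
    (r : ℕ) {ξ : complexBetti (fiberOver f t) (2 * r)} (hξ : ξ ∈ algebraicClasses (fiberOver f t) r)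
    (hprim : ξ ∈ primitiveClasses (complexBetti.map (fiberι f t) 2 K) d (2 * r))
    (hrange : ξ ∈ LinearMap.range (complexBetti.map (fiberι f t) (2 * r)).hom) :
    ξ ∈ (algebraicClasses 𝒳 r).map (complexBetti.map (fiberι f t) (2 * r)).hom :=
  primitiveLift_of_numerical_of_lieberman lieberman1968_lefschetzInvolution_algebraic_abelianVariety_holds hf t K hNum r hξ
    hprim hrange

/-- Display-only shape (no `def`), verbatim as in parts XXI-b/XXI-c: the CM PRIMITIVE LIFT. -/
local notation3 (prettyPrint := false) "CMPrimitiveLift[]" =>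
  ∀ ⦃d : ℕ⦄ ⦃𝒳 S : SchemeOver ℂ⦄ (f : 𝒳 ⟶ S) (_ : IsCompactAbelianPencil f d) (t : ComplexPoints S),
    t ∈ cmLocus f d → ∀ (K : complexBetti 𝒳 2), K ∈ algebraicClasses 𝒳 1 →
    (∀ s : ComplexPoints S, IsPolarizationClass d (fiberOver f s) (complexBetti.map (fiberι f s) 2 K)) →
    ∀ r, 2 ≤ r → 2 * r ≤ d → ∀ ξ ∈ algebraicClasses (fiberOver f t) r,
      ξ ∈ primitiveClasses (complexBetti.map (fiberι f t) 2 K) d (2 * r) →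
      ξ ∈ LinearMap.range (complexBetti.map (fiberι f t) (2 * r)).hom →
      ξ ∈ (algebraicClasses 𝒳 r).map (complexBetti.map (fiberι f t) (2 * r)).hom

/-- Display-only shape (no `def`), verbatim as in part XXI-c: the PRIMITIVE LIFT AT EVERY POINT of every compact abelian pencil. -/
local notation3 (prettyPrint := false) "PrimitiveLiftEverywhere[]" =>
  ∀ ⦃d : ℕ⦄ ⦃𝒳 S : SchemeOver ℂ⦄ (f : 𝒳 ⟶ S) (_ : IsCompactAbelianPencil f d) (t : ComplexPoints S)
    (K : complexBetti 𝒳 2), K ∈ algebraicClasses 𝒳 1 →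
    (∀ s : ComplexPoints S, IsPolarizationClass d (fiberOver f s) (complexBetti.map (fiberι f s) 2 K)) →
    ∀ r, 2 ≤ r → 2 * r ≤ d → ∀ ξ ∈ algebraicClasses (fiberOver f t) r,
      ξ ∈ primitiveClasses (complexBetti.map (fiberι f t) 2 K) d (2 * r) →
      ξ ∈ LinearMap.range (complexBetti.map (fiberι f t) (2 * r)).hom →
      ξ ∈ (algebraicClasses 𝒳 r).map (complexBetti.map (fiberι f t) (2 * r)).hom

/-- **(L) ⟺ [CM primitive lift], with NO binder** (part XXI-c modulo `hL`; part XXI-b had `⟸` only under `HC_CM`).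
[cite: Lieberman1968, main theorem] [cite: Andre1996Motifs, §5.1 (p. 25) and §6.3 (p. 33)] -/
theorem cmFibreAlgebraicLift_iff_cmPrimitiveLift : CMFibreAlgebraicLift ↔ CMPrimitiveLift[] :=
  cmFibreAlgebraicLift_iff_cmPrimitiveLift_of_lieberman lieberman1968_lefschetzInvolution_algebraic_abelianVariety_holds

/-- **(L∀) ⟺ [primitive lift at every point of every compact abelian pencil], with NO binder**.
[cite: Lieberman1968, main theorem] [cite: Abdulali1994FamiliesAV, (1.1) p. 1122] -/
theorem algebraicFixedPart_iff_primitiveLiftEverywhere : AlgebraicFixedPart ↔ PrimitiveLiftEverywhere[] :=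
  algebraicFixedPart_iff_primitiveLiftEverywhere_of_lieberman lieberman1968_lefschetzInvolution_algebraic_abelianVariety_holds

/-- **[primitive lift everywhere] ⟹ (2)** (VHC on compact abelian pencils), with NO binder.
[cite: Abdulali1994FamiliesAV, (1.1) p. 1122] [cite: Lieberman1968, main theorem] -/
theorem compactAbelianPencilVHC_of_primitiveLiftEverywhere (hPrim : PrimitiveLiftEverywhere[]) : CompactAbelianPencilVHC :=
  compactAbelianPencilVHC_of_lieberman_of_primitiveLiftEverywhere
    lieberman1968_lefschetzInvolution_algebraic_abelianVariety_holds hPrim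

/-- **EXACTNESS: `HC_AV ⟺ HC_CM ∧ [primitive lift everywhere]`, modulo André's Lemme 6.3.1 (`h₂₁`) and Verdier 1976 only**
(part XXI-c's row with the `hL` binder removed). [cite: Andre1996Motifs, Lemme 6.3.1 (p. 31) and §6.3 Remarque 2 (p. 33)]
[cite: Verdier1976, Cor. (5.1)] [cite: Lieberman1968, main theorem] -/
theorem HC_AV_iff_HC_CM_and_primitiveLiftEverywhere_of_verdier (h₂₁ : andre1996_cmAnchoredPencil)
    (hGT : Verdier1976_genericLocalTriviality) :
    PadicSemiregularLift.HodgeAbelianVarieties ↔ (RankFourFaces.CMAbelianHodge ∧ PrimitiveLiftEverywhere[]) :=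
  HC_AV_iff_HC_CM_and_primitiveLiftEverywhere_of_verdier_of_lieberman h₂₁ hGT
    lieberman1968_lefschetzInvolution_algebraic_abelianVariety_holds

/-! ## §4 The W₆ habitat row of part XXI-e without its `A(X_t, κ)` clause -/

/-- **`d = 6`, rank-one `H⁴`-invariants at `t`: the lift in EVERY degree ⟺ (Prim)_t(3) alone — at EVERY point, NO clause**
(part XXI-e's `forall_comap_le_sup_iff_primitiveLift_three_of_finrank_range_four_eq_one` with its hypothesis
`A(X_t, κ)` supplied by `standardConjectureA_fiberOver`). The W₆ find-the-cycle problem of RING2-MAP AA2.107 thus reads, on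
every compact pencil of abelian sixfolds with rank-one `H⁴`-invariants and at every point: the André-axis lift holds iff every
`κ_t`-primitive invariant algebraic class of degree `6` on `X_t` is the restriction of a codimension-`3` cycle of the sevenfold.
[cite: Kleiman1968AlgebraicCycles, §3] [cite: Lieberman1968, main theorem] [cite: VoisinHodgeI2002, §6.2.3 Cor. 6.26] -/
theorem forall_comap_le_sup_iff_primitiveLift_three_of_rankOne {f : 𝒳 ⟶ S} (hf : IsCompactAbelianPencil f 6)
    (t : ComplexPoints S) {K : complexBetti 𝒳 2} (hKalg : K ∈ algebraicClasses 𝒳 1)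
    (hK : ∀ s : ComplexPoints S,
      Literature.Geometry.Kaehler.HasHardLefschetzProperty (complexBetti.map (fiberι f s) 2 K) 6)
    (hKt : IsPolarizationClass 6 (fiberOver f t) (complexBetti.map (fiberι f t) 2 K))
    (h1 : Module.finrank ℂ (LinearMap.range (complexBetti.map (fiberι f t) (2 * 2)).hom) = 1) :
    (∀ p : ℕ, (algebraicClasses (fiberOver f t) p).comap (complexBetti.map (fiberι f t) (2 * p)).hom ≤
      algebraicClasses 𝒳 p ⊔ LinearMap.ker (complexBetti.map (fiberι f t) (2 * p)).hom) ↔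
    ∀ ξ ∈ algebraicClasses (fiberOver f t) 3,
      ξ ∈ primitiveClasses (complexBetti.map (fiberι f t) 2 K) 6 (2 * 3) →
      ξ ∈ LinearMap.range (complexBetti.map (fiberι f t) (2 * 3)).hom →
      ξ ∈ (algebraicClasses 𝒳 3).map (complexBetti.map (fiberι f t) (2 * 3)).hom :=
  forall_comap_le_sup_iff_primitiveLift_three_of_finrank_range_four_eq_one hf t hKalg hK hKt
    (standardConjectureA_fiberOver hf t hKt) h1

/-! ## §5 The Lefschetz-flavoured rows of parts II/III (gen 1) without the Abdulali binder `h₈` -/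

/-- **(5) ⟹ (3) with NO binder**: `B` for the total spaces of the CM-pointed compact abelian pencils ⟹ VHC on CM-pointed
pencils (part III's `cmPointedPencilVHC_of_abdulali_of_lefschetzBCMPointedPencils`, `h₈ := abdulali1994_holds`).
[cite: Abdulali1994FamiliesAV, p. 1122] [cite: Milne2020HodgeClassesAV, Prop. 1 (p. 7)] -/
theorem cmPointedPencilVHC_of_lefschetzBCMPointedPencils (hB : LefschetzBCMPointedPencils) : CMPointedPencilVHC :=
  cmPointedPencilVHC_of_abdulali_of_lefschetzBCMPointedPencils abdulali1994_holds hB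

/-- **(5∀) ⟹ (2) with NO binder**: `B` for the total spaces of all compact abelian pencils ⟹ VHC on compact abelian pencils.
[cite: Milne2020HodgeClassesAV, Thm. 4 (p. 8)] [cite: Abdulali1994FamiliesAV, p. 1122] -/
theorem compactAbelianPencilVHC_of_lefschetzBCompactPencils (hB : LefschetzBCompactPencils) : CompactAbelianPencilVHC :=
  compactAbelianPencilVHC_of_abdulali_of_lefschetzBCompactPencils abdulali1994_holds hB

/-- **THE LEFSCHETZ-FLAVOURED CELL DELIVERABLE `HC_CM → (5) → HC_AV`, now modulo André's Lemme 6.3.1 (`h₂₁`) ONLY** (part III's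
row had the binders `h₂₁`, `h₈`; `h₈` is `abdulali1994_holds`). The open content of (5) is `B` for the `(2 dim A + 1)`-dimensional
total spaces of CM-anchored compact abelian pencils. research route, not a corollary; conditional on HC_CM plus one named
minimal statement. [cite: Andre1996Motifs, Lemme 6.3.1 (p. 31) and Remarque 2 (p. 33)] [cite: Abdulali1994FamiliesAV, p. 1122] -/
theorem HC_AV_of_HC_CM_of_lefschetzBCMPointedPencils (h₂₁ : andre1996_cmAnchoredPencil) (hCM : RankFourFaces.CMAbelianHodge)
    (hB : LefschetzBCMPointedPencils) : PadicSemiregularLift.HodgeAbelianVarieties :=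
  HC_AV_of_HC_CM_of_abdulali_of_lefschetzBCMPointedPencils h₂₁ abdulali1994_holds hCM hB

/-- **KIND-1 witness without `h₈`**: granted André's Lemme 6.3.1 and Lemmes 6.3.2–6.3.3 only, `B` on all compact abelian pencil
total spaces gives `HC_AV` with NO `HC_CM` (André's Remarque 2 / Milne's Thm. 4 for compact pencils).
[cite: Andre1996Motifs, Remarque 2 (p. 33)] [cite: Milne2020HodgeClassesAV, Thm. 4 (p. 8)] -/
theorem HC_AV_of_andre1996_of_lefschetzBCompactPencils (h₂₁ : andre1996_cmAnchoredPencil)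
    (h₂₂ : andre1996_cmHodgeClasses_algebraicallyAnchoredPencils) (hB : LefschetzBCompactPencils) :
    PadicSemiregularLift.HodgeAbelianVarieties :=
  HC_AV_of_andre1996_of_abdulali_of_lefschetzBCompactPencils h₂₁ h₂₂ abdulali1994_holds hB

end Summit.HodgeConjecture.HodgeConjecture.Ring2.AbelianAll

end
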